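import Summits.AtomisticToContinuum.HydrodynamicLimit.Theorems.CollisionIsometryCLTCollisionalTransferLocalityBlockVelocityLLNConst
import Summits.AtomisticToContinuum.HydrodynamicLimit.Theorems.CollisionIsometryCLTCollisionalTransferLocalityGaussMarks
import HarnessLib

/-!
# The dominators of the block traceless kinetic stress vanish in mean (line `hemisphere-affine-slaving`)

Support file (`--supports stmt-AtomisticToContinuum-9518`) of the lead prover of the line
`hemisphere-affine-slaving` for the crux `CollisionalTransferLocality`, landing the registered stub
`stub_blockStressDominatorConst` ([KS-D']): statics under the homogeneous local Gibbs law
`G_N = localGibbsLaw σ 1 0 θ N (Φ N)` (`σ ≤ 1/2`, `θ > 0`, any flow family). For an admissible kernel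
family `φ_N` (`0 ≤ φ_N ≤ C (N+1)^{3γ}`, mass one, `0 < γ ≤ 1/15`) the two dominators of the block
traceless kinetic stress have vanishing mean, `E ∫ₓ [A + B] dx → 0` with
`A = Σ_jk ((N+1)⁻¹ Σᵢ φ(xᵢ − x) (v_{ij} v_{ik} − θ δ_jk))²` and `B = |m̄|² (Ē / ρ̄)`.

## Proof (second moments, integrating over `x` first; a Young splitting for `B`)

* `A` is handled verbatim as in `…BlockVelocityLLNConst`: the nine marks `v_j v_k − θ δ_jk` are
  centred under `N(0, θ id)` (`integral_coord_mul_coord_gaussMeasure_zero`) and square integrable, so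
  after integrating over the torus (`integral_sq_wsum`) only the diagonal pair terms survive
  (`integral_doubleSum_le`): `E ∫ₓ A ≤ ‖φ_N‖_∞ K / (N+1)`.
* `B`: pointwise, by the weighted Cauchy–Schwarz inequality `|m̄|² ≤ 2 ρ̄ Ē` (`norm_mB_sq_le`) and
  Young's inequality with parameter `s = √(N+1)`,
  `|m̄|² Ē/ρ̄ = (3θ/2)|m̄|² + (|m̄|²/ρ̄)(Ē − (3θ/2)ρ̄) ≤ (3θ/2)|m̄|² + s⁻¹ Ē² + s (Ē − (3θ/2)ρ̄)²`
  (`mul_div_le_of_le_two_mul`; both sides vanish on empty blocks). The first and third terms are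
  squares of weighted sums of the CENTRED marks `v_l`, `|v|²/2 − 3θ/2`, of mean `≤ ‖φ_N‖_∞ K/(N+1)`;
  the middle one is the square of the weighted sum of the mark `|v|²/2`, of mean
  `≤ ‖φ_N‖_∞ E(|v|²/2)²` by the crude bound `q(vᵢ) q(vⱼ) A(xᵢ, xⱼ) ≤ ‖φ‖_∞ (q(vᵢ)² + q(vⱼ)²)/2`
  (`integral_sqAvg_le`). Altogether `E ∫ₓ (A + B) ≤ ‖φ_N‖_∞ K_θ / √(N+1) ≤ C K_θ (N+1)^{3γ − 1/2} → 0`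
  since `3γ ≤ 1/5 < 1/2` (`lintegral_dominator_le`, `tendsto_ofReal_mul_rpow_div_sqrt`).
* The two `lintegral`s are honest Bochner integrals of nonnegative integrable functions
  (`ofReal_integral_eq_lintegral_ofReal`); no Fubini is needed, the bound being pointwise in `z`.

Folklore (second moments of block averages of i.i.d. Maxwellian velocities); the product structure of
the homogeneous local Gibbs law is Spohn 1991, Part I §2.3, already recorded on the imported tools.
No dynamics enters.
-/

namespace Summit.AtomisticToContinuum.HydrodynamicLimit.Theorems.HemisphereAffineSlaving

open scoped BigOperators Topology Classical ENNReal InnerProductSpace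
open Filter Set Function MeasureTheory

noncomputable section

open Literature.MathematicalPhysics.KineticTheory (T3 V3)
open Literature.MathematicalPhysics.KineticTheory (gaussMeasure localGibbsLaw memLp_coord_gaussMeasure
  memLp_energy_gaussMeasure integral_coord_gaussMeasure integral_energy_gaussMeasure)

namespace BlockStressDominatorConst

open BlockVelocityLLNConst

variable {N : ℕ}

/-! ### Pathwise algebra -/

/-- `|m̄|² = Σ_l ((N+1)⁻¹ Σᵢ φ(xᵢ − x) v_{il})²`. [folklore] -/
theorem normSq_mB_eq (φ : ℕ → T3 → ℝ) (w : Cfg N) (x : T3) :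
    ‖mB φ N w x‖ ^ 2 = ∑ l, (((N : ℝ) + 1)⁻¹ * ∑ i, φ N ((w i).1 - x) * (w i).2 l) ^ 2 := by
  rw [EuclideanSpace.real_norm_sq_eq]
  exact Finset.sum_congr rfl fun l _ => by rw [mB_apply, Nat.cast_add, Nat.cast_one]

/-- `Ē − (3θ/2) ρ̄ = (N+1)⁻¹ Σᵢ φ(xᵢ − x) (|vᵢ|²/2 − 3θ/2)`. [folklore] -/
theorem fluct_eq (θ : ℝ) (φ : ℕ → T3 → ℝ) (w : Cfg N) (x : T3) :
    EB φ N w x - 3 / 2 * θ * rhoB φ N w x =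
      ((N : ℝ) + 1)⁻¹ * ∑ i, φ N ((w i).1 - x) * (‖(w i).2‖ ^ 2 / 2 - 3 / 2 * θ) := by
  rw [EB_eq, rhoB_eq, Nat.cast_add, Nat.cast_one]
  simp only [Finset.mul_sum, ← Finset.sum_sub_distrib]
  exact Finset.sum_congr rfl fun i _ => by ring

/-- Elementary (the Young splitting): if `0 ≤ m ≤ 2 r E` with `r, c ≥ 0` and `s > 0` then
`m (E / r) ≤ c m + s⁻¹ E² + s (E − c r)²` (with Lean's `E / 0 = 0` on empty blocks). [folklore] -/
theorem mul_div_le_of_le_two_mul {m r E c s : ℝ} (hm0 : 0 ≤ m) (hr : 0 ≤ r) (hc : 0 ≤ c)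
    (hs : 0 < s) (hm : m ≤ 2 * r * E) :
    m * (E / r) ≤ c * m + s⁻¹ * E ^ 2 + s * (E - c * r) ^ 2 := by
  rcases hr.eq_or_lt with hr0 | hr0
  · rw [← hr0, div_zero, mul_zero]; positivity
  have h1 : m / r ≤ 2 * E := by rw [div_le_iff₀ hr0]; linarith
  have h2 : m * (E / r) = c * m + m / r * (E - c * r) := by field_simp; ring
  have h3 : m / r * (E - c * r) ≤ 2 * E * |E - c * r| :=
    (le_abs_self _).trans (by
      rw [abs_mul, abs_of_nonneg (div_nonneg hm0 hr)]
      exact mul_le_mul_of_nonneg_right h1 (abs_nonneg _))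
  have h4 : 2 * E * |E - c * r| ≤ s⁻¹ * E ^ 2 + s * (E - c * r) ^ 2 := by
    have hid : s⁻¹ * E ^ 2 + s * |E - c * r| ^ 2 - 2 * E * |E - c * r| =
        s⁻¹ * (E - s * |E - c * r|) ^ 2 := by field_simp; ring
    rw [← sq_abs (E - c * r), ← sub_nonneg, hid]
    positivity
  linarith

/-- Elementary bookkeeping of the rate: with `a ≤ b` and `M, X, Y, c ≥ 0`,
`a M X + c a M Y + b M Z + b M W ≤ M b (X + c Y + Z + W)`. [folklore] -/
theorem rate_alg {a b M X Y Z W c : ℝ} (hab : a ≤ b) (hM : 0 ≤ M) (hX : 0 ≤ X) (hY : 0 ≤ Y)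
    (hc : 0 ≤ c) :
    a * (M * X) + (c * (a * (M * Y)) + b * (M * Z) + b * (M * W)) ≤ M * b * (X + c * Y + Z + W) := by
  have h1 := mul_le_mul_of_nonneg_right hab (mul_nonneg hM hX)
  have h2 := mul_le_mul_of_nonneg_left (mul_le_mul_of_nonneg_right hab (mul_nonneg hM hY)) hc
  nlinarith [h1, h2]

/-! ### Expectations under the homogeneous local Gibbs law -/

/-- **Crude pair bound**: `E[q(vᵢ) q(vⱼ) A(xᵢ, xⱼ)] ≤ M E q²` for all `i, j` and every mark
`q ∈ L²(N(0, θ id))`, centred or not (`q(vᵢ) q(vⱼ) A ≤ M (q(vᵢ)² + q(vⱼ)²)/2` as `0 ≤ A ≤ M`, each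
velocity being `N(0, θ id)`-distributed). [folklore] -/
theorem integral_pairTerm_le {σ θ : ℝ} (hθ : 0 < θ) (hσ : σ ≤ 1 / 2) (Φ : Flows σ) (N : ℕ)
    {f : T3 → ℝ} (hf : Continuous f) (hf0 : ∀ y, 0 ≤ f y) {M : ℝ} (hfM : ∀ y, f y ≤ M)
    (hf1 : ∫ y, f y = 1) {q : V3 → ℝ} (hq : Continuous q)
    (hq2 : MemLp q 2 (gaussMeasure (0 : V3) θ)) (i j : Fin (N + 1)) :
    ∫ z, q (z i).2 * q (z j).2 * (∫ x, f ((z i).1 - x) * f ((z j).1 - x))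
        ∂(localGibbsLaw σ (fun _ => 1) (fun _ => 0) (fun _ => θ) N (Φ N)) ≤
      M * ∫ v, q v ^ 2 ∂(gaussMeasure (0 : V3) θ) := by
  have hsq : Integrable (fun v => q v ^ 2) (gaussMeasure (0 : V3) θ) := hq2.integrable_sq
  have hqi := integrable_sq_vel hθ hσ Φ N hq2
  have hpt : ∀ z : Cfg N, q (z i).2 * q (z j).2 * (∫ x, f ((z i).1 - x) * f ((z j).1 - x)) ≤
      M / 2 * (q (z i).2 ^ 2 + q (z j).2 ^ 2) := fun z => by
    have hA := overlap_le hf hf0 hfM hf1 (z i).1 (z j).1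
    have hA0 := overlap_nonneg hf0 (z i).1 (z j).1
    have h1 : q (z i).2 * q (z j).2 ≤ (q (z i).2 ^ 2 + q (z j).2 ^ 2) / 2 := by
      nlinarith [sq_nonneg (q (z i).2 - q (z j).2)]
    calc q (z i).2 * q (z j).2 * ∫ x, f ((z i).1 - x) * f ((z j).1 - x)
        ≤ (q (z i).2 ^ 2 + q (z j).2 ^ 2) / 2 * ∫ x, f ((z i).1 - x) * f ((z j).1 - x) :=
          mul_le_mul_of_nonneg_right h1 hA0
      _ ≤ (q (z i).2 ^ 2 + q (z j).2 ^ 2) / 2 * M := mul_le_mul_of_nonneg_left hA (by positivity)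
      _ = M / 2 * (q (z i).2 ^ 2 + q (z j).2 ^ 2) := by ring
  refine (integral_mono (integrable_pairTerm hθ hσ Φ N hf hf0 hfM hf1 hq hq2 i j)
    (((hqi i).fun_add (hqi j)).const_mul (M / 2)) hpt).trans (le_of_eq ?_)
  rw [integral_const_mul, integral_add (hqi i) (hqi j),
    integral_vel_localGibbsLaw_const one_pos hθ hσ 0 Φ N i hsq,
    integral_vel_localGibbsLaw_const one_pos hθ hσ 0 Φ N j hsq]
  ring

/-- **Squared weighted averages, `x` integrated out, in mean.** For a mark `q ∈ L²(N(0, θ id))`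
and a kernel `0 ≤ φ ≤ M` of mass one, `z ↦ ∫ₓ ((N+1)⁻¹ Σᵢ φ(xᵢ − x) q(vᵢ))² dx` is integrable under
the homogeneous local Gibbs law with mean `≤ M E q²` (crude bound, `integral_pairTerm_le`), and
`≤ (N+1)⁻¹ M E q²` if the mark is centred (only diagonal pair terms survive,
`integral_doubleSum_le`); `integral_sq_wsum` integrates over the torus first. [folklore] -/
theorem integral_sqAvg_le {σ θ : ℝ} (hθ : 0 < θ) (hσ : σ ≤ 1 / 2) (Φ : Flows σ) (N : ℕ)
    {φ : ℕ → T3 → ℝ} (hφc : Continuous (φ N)) (hφ0 : ∀ y, 0 ≤ φ N y) {M : ℝ}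
    (hφM : ∀ y, φ N y ≤ M) (hφ1 : ∫ y, φ N y = 1) {q : V3 → ℝ} (hq : Continuous q)
    (hq2 : MemLp q 2 (gaussMeasure (0 : V3) θ)) :
    Integrable (fun z : Cfg N =>
        ∫ x, (((N : ℝ) + 1)⁻¹ * ∑ i, φ N ((z i).1 - x) * q (z i).2) ^ 2)
        (localGibbsLaw σ (fun _ => 1) (fun _ => 0) (fun _ => θ) N (Φ N)) ∧
      ∫ z, (∫ x, (((N : ℝ) + 1)⁻¹ * ∑ i, φ N ((z i).1 - x) * q (z i).2) ^ 2)
          ∂(localGibbsLaw σ (fun _ => 1) (fun _ => 0) (fun _ => θ) N (Φ N)) ≤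
        M * ∫ v, q v ^ 2 ∂(gaussMeasure (0 : V3) θ) ∧
      (∫ v, q v ∂(gaussMeasure (0 : V3) θ) = 0 →
        ∫ z, (∫ x, (((N : ℝ) + 1)⁻¹ * ∑ i, φ N ((z i).1 - x) * q (z i).2) ^ 2)
            ∂(localGibbsLaw σ (fun _ => 1) (fun _ => 0) (fun _ => θ) N (Φ N)) ≤
          ((N : ℝ) + 1)⁻¹ * (M * ∫ v, q v ^ 2 ∂(gaussMeasure (0 : V3) θ))) := by
  have hn : (N : ℝ) + 1 ≠ 0 := by positivity
  have hT := integrable_pairTerm hθ hσ Φ N hφc hφ0 hφM hφ1 hq hq2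
  have heq : (fun z : Cfg N => ∫ x, (((N : ℝ) + 1)⁻¹ * ∑ i, φ N ((z i).1 - x) * q (z i).2) ^ 2) =
      fun z => ((N : ℝ) + 1)⁻¹ ^ 2 * ∑ i, ∑ j, q (z i).2 * q (z j).2 *
        ∫ x, φ N ((z i).1 - x) * φ N ((z j).1 - x) :=
    funext fun z => integral_sq_wsum hφc (fun i => (z i).1) (fun i => q (z i).2) _
  have hI : Integrable (fun z : Cfg N => ∑ i, ∑ j, q (z i).2 * q (z j).2 *
      ∫ x, φ N ((z i).1 - x) * φ N ((z j).1 - x))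
      (localGibbsLaw σ (fun _ => 1) (fun _ => 0) (fun _ => θ) N (Φ N)) :=
    integrable_finsetSum _ fun i _ => integrable_finsetSum _ fun j _ => hT i j
  rw [heq]
  refine ⟨hI.const_mul _, ?_, fun hq0 => ?_⟩
  · rw [integral_const_mul, integral_finsetSum _ fun i _ => integrable_finsetSum _ fun j _ => hT i j]
    calc ((N : ℝ) + 1)⁻¹ ^ 2 * ∑ i, ∫ z, ∑ j, q (z i).2 * q (z j).2 *
            (∫ x, φ N ((z i).1 - x) * φ N ((z j).1 - x))
            ∂(localGibbsLaw σ (fun _ => 1) (fun _ => 0) (fun _ => θ) N (Φ N))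
        ≤ ((N : ℝ) + 1)⁻¹ ^ 2 * ∑ _i : Fin (N + 1), ∑ _j : Fin (N + 1),
            M * ∫ v, q v ^ 2 ∂(gaussMeasure (0 : V3) θ) :=
          mul_le_mul_of_nonneg_left (Finset.sum_le_sum fun i _ => by
            rw [integral_finsetSum _ fun j _ => hT i j]
            exact Finset.sum_le_sum fun j _ =>
              integral_pairTerm_le hθ hσ Φ N hφc hφ0 hφM hφ1 hq hq2 i j) (sq_nonneg _)
      _ = M * ∫ v, q v ^ 2 ∂(gaussMeasure (0 : V3) θ) := by
          simp only [Finset.sum_const, Finset.card_univ, Fintype.card_fin, nsmul_eq_mul, Nat.cast_add,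
            Nat.cast_one]
          rw [sq, mul_assoc, inv_mul_cancel_left₀ hn, inv_mul_cancel_left₀ hn]
  · rw [integral_const_mul]
    refine (mul_le_mul_of_nonneg_left
      (integral_doubleSum_le hθ hσ Φ N hφc hφ0 hφM hφ1 hq hq2 hq0).2 (sq_nonneg _)).trans (le_of_eq ?_)
    rw [sq, mul_assoc, inv_mul_cancel_left₀ hn]

/-! ### The mean of the two dominators at fixed `N` -/

/-- **Mean bound at fixed `N`.** Under the homogeneous local Gibbs law (`σ ≤ 1/2`, `θ > 0`) and
for a continuous kernel `0 ≤ φ_N ≤ M` of mass one, `E ∫ₓ (A + B) ≤ (M/√(N+1)) K_θ` with the Gaussian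
constant `K_θ = Σ_jk E(v_j v_k − θδ_jk)² + (3θ/2) Σ_l E v_l² + E(|v|²/2)² + E(|v|²/2 − 3θ/2)²` of
`N(0, θ id)`: pointwise Young splitting of `B` (`mul_div_le_of_le_two_mul` with `s = √(N+1)`),
integration over `x` first and the mean bounds `integral_sqAvg_le` for the marks `v_j v_k − θδ_jk`,
`v_l`, `|v|²/2 − 3θ/2` (centred) and `|v|²/2` (crude). [folklore] -/
theorem lintegral_dominator_le {σ θ : ℝ} (hθ : 0 < θ) (hσ : σ ≤ 1 / 2) (Φ : Flows σ) (N : ℕ)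
    {φ : ℕ → T3 → ℝ} (hφc : Continuous (φ N)) (hφ0 : ∀ y, 0 ≤ φ N y) {M : ℝ}
    (hφM : ∀ y, φ N y ≤ M) (hφ1 : ∫ y, φ N y = 1) :
    ∫⁻ z, (∫⁻ x : T3, ENNReal.ofReal ((∑ j : Fin 3, ∑ k : Fin 3, (((N : ℝ) + 1)⁻¹ *
        ∑ i : Fin (N + 1), φ N ((z i).1 - x) * ((z i).2 j * (z i).2 k - if j = k then θ else 0)) ^ 2) +
        ‖mB φ N z x‖ ^ 2 * (EB φ N z x / rhoB φ N z x)))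
      ∂(localGibbsLaw σ (fun _ => 1) (fun _ => 0) (fun _ => θ) N (Φ N)) ≤
      ENNReal.ofReal (M / Real.sqrt ((N : ℝ) + 1) *
        ((∑ j : Fin 3, ∑ k : Fin 3,
            ∫ v, (v j * v k - if j = k then θ else 0) ^ 2 ∂(gaussMeasure (0 : V3) θ)) +
          3 / 2 * θ * (∑ l : Fin 3, ∫ v, v l ^ 2 ∂(gaussMeasure (0 : V3) θ)) +
          ∫ v, (‖v‖ ^ 2 / 2) ^ 2 ∂(gaussMeasure (0 : V3) θ) +
          ∫ v, (‖v‖ ^ 2 / 2 - 3 / 2 * θ) ^ 2 ∂(gaussMeasure (0 : V3) θ))) := by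
  set P := localGibbsLaw σ (fun _ => (1 : ℝ)) (fun _ => (0 : V3)) (fun _ => θ) N (Φ N)
  have hn : (0 : ℝ) < (N : ℝ) + 1 := by positivity
  set s : ℝ := Real.sqrt ((N : ℝ) + 1) with hs_def
  have hs : 0 < s := Real.sqrt_pos.2 hn
  have hs2 : s ^ 2 = (N : ℝ) + 1 := Real.sq_sqrt hn.le
  have hs1 : 1 ≤ s := Real.one_le_sqrt.2 (by linarith [(Nat.cast_nonneg N : (0 : ℝ) ≤ N)])
  have hM0 : 0 ≤ M := (hφ0 0).trans (hφM 0)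
  have hθ' : (0 : ℝ) ≤ 3 / 2 * θ := by positivity
  -- the marks: continuity, square integrability, centring
  have hcc : ∀ l : Fin 3, Continuous fun v : V3 => v l := fun l =>
    (EuclideanSpace.proj (𝕜 := ℝ) l).continuous
  have hc2 : ∀ l : Fin 3, MemLp (fun v : V3 => v l) 2 (gaussMeasure (0 : V3) θ) := fun l =>
    memLp_coord_gaussMeasure (0 : V3) θ l 2 (by simp)
  have hc0 : ∀ l : Fin 3, ∫ v, v l ∂(gaussMeasure (0 : V3) θ) = 0 := fun l => by
    rw [integral_coord_gaussMeasure (0 : V3) hθ l]; rfl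
  have hqc : ∀ j k : Fin 3, Continuous fun v : V3 => v j * v k - if j = k then θ else 0 :=
    fun j k => ((hcc j).mul (hcc k)).sub continuous_const
  have hq2 : ∀ j k : Fin 3, MemLp (fun v : V3 => v j * v k - if j = k then θ else 0) 2
      (gaussMeasure (0 : V3) θ) := fun j k =>
    (memLp_two_coord_mul_coord_gaussMeasure θ j k).sub (memLp_const _)
  have hq0 : ∀ j k : Fin 3,
      ∫ v, (v j * v k - if j = k then θ else 0) ∂(gaussMeasure (0 : V3) θ) = 0 := by
    intro j k
    rw [integral_sub ((memLp_two_coord_mul_coord_gaussMeasure θ j k).integrable one_le_two)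
      (integrable_const _), integral_coord_mul_coord_gaussMeasure_zero hθ j k, integral_const,
      probReal_univ, one_smul, sub_self]
  have hec : Continuous fun v : V3 => ‖v‖ ^ 2 / 2 := by fun_prop
  have he2 : MemLp (fun v : V3 => ‖v‖ ^ 2 / 2) 2 (gaussMeasure (0 : V3) θ) := by
    simpa only [sub_zero] using memLp_energy_gaussMeasure (0 : V3) θ 0
  have hfc : Continuous fun v : V3 => ‖v‖ ^ 2 / 2 - 3 / 2 * θ := by fun_prop
  have hf2 : MemLp (fun v : V3 => ‖v‖ ^ 2 / 2 - 3 / 2 * θ) 2 (gaussMeasure (0 : V3) θ) :=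
    memLp_energy_gaussMeasure (0 : V3) θ (3 / 2 * θ)
  have hf0 : ∫ v, (‖v‖ ^ 2 / 2 - 3 / 2 * θ) ∂(gaussMeasure (0 : V3) θ) = 0 := by
    have h := integral_energy_gaussMeasure (0 : V3) hθ
    have hfun : (fun v : V3 => ‖v‖ ^ 2 / 2 - ‖(0 : V3)‖ ^ 2 / 2 - (Fintype.card (Fin 3) : ℝ) * θ / 2) =
        fun v : V3 => ‖v‖ ^ 2 / 2 - 3 / 2 * θ := by
      funext v; rw [norm_zero, Fintype.card_fin]; push_cast; ring
    rwa [hfun] at h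
  -- mean bounds for the squared weighted averages of the marks
  have hW := fun (q : V3 → ℝ) (hq : Continuous q) (hq2 : MemLp q 2 (gaussMeasure (0 : V3) θ)) =>
    integral_sqAvg_le hθ hσ Φ N hφc hφ0 hφM hφ1 hq hq2
  -- the pointwise dominating function `U` and its `x`-integral `D`
  set U : Cfg N → T3 → ℝ := fun z x =>
    (∑ j : Fin 3, ∑ k : Fin 3, (((N : ℝ) + 1)⁻¹ *
        ∑ i : Fin (N + 1), φ N ((z i).1 - x) * ((z i).2 j * (z i).2 k - if j = k then θ else 0)) ^ 2) +
      (3 / 2 * θ * (∑ l, (((N : ℝ) + 1)⁻¹ * ∑ i, φ N ((z i).1 - x) * (z i).2 l) ^ 2) +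
        s⁻¹ * (((N : ℝ) + 1)⁻¹ * ∑ i, φ N ((z i).1 - x) * (‖(z i).2‖ ^ 2 / 2)) ^ 2 +
        s * (((N : ℝ) + 1)⁻¹ * ∑ i, φ N ((z i).1 - x) * (‖(z i).2‖ ^ 2 / 2 - 3 / 2 * θ)) ^ 2)
    with hU
  set D : Cfg N → ℝ := fun z =>
    (∑ j : Fin 3, ∑ k : Fin 3, ∫ x, (((N : ℝ) + 1)⁻¹ *
        ∑ i : Fin (N + 1), φ N ((z i).1 - x) * ((z i).2 j * (z i).2 k - if j = k then θ else 0)) ^ 2) +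
      (3 / 2 * θ * (∑ l, ∫ x, (((N : ℝ) + 1)⁻¹ * ∑ i, φ N ((z i).1 - x) * (z i).2 l) ^ 2) +
        s⁻¹ * (∫ x, (((N : ℝ) + 1)⁻¹ * ∑ i, φ N ((z i).1 - x) * (‖(z i).2‖ ^ 2 / 2)) ^ 2) +
        s * (∫ x, (((N : ℝ) + 1)⁻¹ * ∑ i, φ N ((z i).1 - x) * (‖(z i).2‖ ^ 2 / 2 - 3 / 2 * θ)) ^ 2))
    with hD
  -- pointwise domination `A + B ≤ U`
  have hAB : ∀ z x, (∑ j : Fin 3, ∑ k : Fin 3, (((N : ℝ) + 1)⁻¹ *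
      ∑ i : Fin (N + 1), φ N ((z i).1 - x) * ((z i).2 j * (z i).2 k - if j = k then θ else 0)) ^ 2) +
      ‖mB φ N z x‖ ^ 2 * (EB φ N z x / rhoB φ N z x) ≤ U z x := by
    intro z x
    simp only [hU]
    refine add_le_add le_rfl ?_
    calc ‖mB φ N z x‖ ^ 2 * (EB φ N z x / rhoB φ N z x)
        ≤ 3 / 2 * θ * ‖mB φ N z x‖ ^ 2 + s⁻¹ * EB φ N z x ^ 2 +
            s * (EB φ N z x - 3 / 2 * θ * rhoB φ N z x) ^ 2 :=
          mul_div_le_of_le_two_mul (sq_nonneg _) (rhoB_nonneg hφ0) hθ' hs (norm_mB_sq_le hφ0)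
      _ = _ := by rw [fluct_eq, EB_eq, Nat.cast_add, Nat.cast_one, normSq_mB_eq]
  have hU0 : ∀ z x, 0 ≤ U z x := fun z x => by simp only [hU]; positivity
  have hUi : ∀ z, Integrable (U z) := fun z => by
    simp only [hU]
    exact Continuous.integrable_unitAddTorus (by fun_prop)
  -- integrating over `x`
  have hIjk : ∀ (z : Cfg N) (j k : Fin 3), Integrable (fun x : T3 => (((N : ℝ) + 1)⁻¹ *
      ∑ i : Fin (N + 1), φ N ((z i).1 - x) * ((z i).2 j * (z i).2 k - if j = k then θ else 0)) ^ 2) :=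
    fun z j k => Continuous.integrable_unitAddTorus (by fun_prop)
  have hIl : ∀ (z : Cfg N) (l : Fin 3), Integrable (fun x : T3 =>
      (((N : ℝ) + 1)⁻¹ * ∑ i, φ N ((z i).1 - x) * (z i).2 l) ^ 2) :=
    fun z l => Continuous.integrable_unitAddTorus (by fun_prop)
  have hFD : ∀ z, ∫ x, U z x = D z := by
    intro z
    simp only [hU, hD]
    rw [integral_add (integrable_finsetSum _ fun j _ => integrable_finsetSum _ fun k _ => hIjk z j k)
        (Continuous.integrable_unitAddTorus (by fun_prop)),
      integral_add (Continuous.integrable_unitAddTorus (by fun_prop))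
        (Continuous.integrable_unitAddTorus (by fun_prop)),
      integral_add (Continuous.integrable_unitAddTorus (by fun_prop))
        (Continuous.integrable_unitAddTorus (by fun_prop)),
      integral_const_mul, integral_const_mul, integral_const_mul,
      integral_finsetSum _ fun j _ => integrable_finsetSum _ fun k _ => hIjk z j k,
      integral_finsetSum _ fun l _ => hIl z l]
    congr 1
    exact Finset.sum_congr rfl fun j _ => integral_finsetSum _ fun k _ => hIjk z j k
  -- integrating over `z`
  have hIA : Integrable (fun z : Cfg N => ∑ j : Fin 3, ∑ k : Fin 3, ∫ x, (((N : ℝ) + 1)⁻¹ *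
      ∑ i : Fin (N + 1), φ N ((z i).1 - x) * ((z i).2 j * (z i).2 k - if j = k then θ else 0)) ^ 2) P :=
    integrable_finsetSum _ fun j _ => integrable_finsetSum _ fun k _ => (hW _ (hqc j k) (hq2 j k)).1
  have hIm := (integrable_finsetSum Finset.univ fun l _ => (hW _ (hcc l) (hc2 l)).1).const_mul
    (3 / 2 * θ)
  have hIe := (hW _ hec he2).1.const_mul s⁻¹
  have hIf := (hW _ hfc hf2).1.const_mul s
  have hDi : Integrable D P := hIA.fun_add ((hIm.fun_add hIe).fun_add hIf)
  have hD0 : ∀ z, 0 ≤ D z := fun z => (hFD z) ▸ integral_nonneg (hU0 z)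
  have hkey1 : ((N : ℝ) + 1)⁻¹ ≤ s⁻¹ :=
    inv_anti₀ hs (by rw [← hs2]; exact le_self_pow₀ hs1 two_ne_zero)
  have hkey2 : s * ((N : ℝ) + 1)⁻¹ = s⁻¹ := by
    rw [← hs2, sq, mul_inv, ← mul_assoc, mul_inv_cancel₀ hs.ne', one_mul]
  have hX0 : 0 ≤ ∑ j : Fin 3, ∑ k : Fin 3,
      ∫ v, (v j * v k - if j = k then θ else 0) ^ 2 ∂(gaussMeasure (0 : V3) θ) :=
    Finset.sum_nonneg fun j _ => Finset.sum_nonneg fun k _ => integral_nonneg fun v => sq_nonneg _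
  have hY0 : 0 ≤ ∑ l : Fin 3, ∫ v, v l ^ 2 ∂(gaussMeasure (0 : V3) θ) :=
    Finset.sum_nonneg fun l _ => integral_nonneg fun v => sq_nonneg _
  have hDle : ∫ z, D z ∂P ≤ M / s *
      ((∑ j : Fin 3, ∑ k : Fin 3,
          ∫ v, (v j * v k - if j = k then θ else 0) ^ 2 ∂(gaussMeasure (0 : V3) θ)) +
        3 / 2 * θ * (∑ l : Fin 3, ∫ v, v l ^ 2 ∂(gaussMeasure (0 : V3) θ)) +
        ∫ v, (‖v‖ ^ 2 / 2) ^ 2 ∂(gaussMeasure (0 : V3) θ) +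
        ∫ v, (‖v‖ ^ 2 / 2 - 3 / 2 * θ) ^ 2 ∂(gaussMeasure (0 : V3) θ)) := by
    simp only [hD]
    rw [integral_add hIA ((hIm.fun_add hIe).fun_add hIf), integral_add (hIm.fun_add hIe) hIf,
      integral_add hIm hIe, integral_const_mul, integral_const_mul, integral_const_mul,
      integral_finsetSum _ fun j _ => integrable_finsetSum _ fun k _ => (hW _ (hqc j k) (hq2 j k)).1,
      integral_finsetSum _ fun l _ => (hW _ (hcc l) (hc2 l)).1]
    refine (add_le_add (Finset.sum_le_sum fun j _ =>
      (integral_finsetSum _ fun k _ => (hW _ (hqc j k) (hq2 j k)).1).trans_le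
        (Finset.sum_le_sum fun k _ => (hW _ (hqc j k) (hq2 j k)).2.2 (hq0 j k)))
      (add_le_add (add_le_add
        (mul_le_mul_of_nonneg_left (Finset.sum_le_sum fun l _ => (hW _ (hcc l) (hc2 l)).2.2 (hc0 l)) hθ')
        (mul_le_mul_of_nonneg_left (hW _ hec he2).2.1 (inv_nonneg.2 hs.le)))
        (mul_le_mul_of_nonneg_left ((hW _ hfc hf2).2.2 hf0) hs.le))).trans ?_
    simp only [← Finset.mul_sum]
    rw [← mul_assoc s, hkey2, div_eq_mul_inv]
    exact rate_alg hkey1 hM0 hX0 hY0 hθ'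
  -- assembling
  calc _ ≤ ∫⁻ z, ENNReal.ofReal (D z) ∂P := lintegral_mono fun z => by
          calc _ ≤ ∫⁻ x, ENNReal.ofReal (U z x) :=
                lintegral_mono fun x => ENNReal.ofReal_le_ofReal (hAB z x)
            _ = ENNReal.ofReal (∫ x, U z x) :=
                (ofReal_integral_eq_lintegral_ofReal (hUi z) (ae_of_all _ (hU0 z))).symm
            _ = ENNReal.ofReal (D z) := by rw [hFD z]
    _ = ENNReal.ofReal (∫ z, D z ∂P) :=
        (ofReal_integral_eq_lintegral_ofReal hDi (ae_of_all _ hD0)).symm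
    _ ≤ _ := ENNReal.ofReal_le_ofReal hDle

/-- The rate: `c (n + 1)^{3γ} / √(n + 1) = c (n + 1)^{3γ − 1/2} → 0` in `ℝ≥0∞` for `γ ≤ 1/15`.
[folklore] -/
theorem tendsto_ofReal_mul_rpow_div_sqrt {γ : ℝ} (hγ : γ ≤ 1 / 15) (c : ℝ) :
    Tendsto (fun N : ℕ => ENNReal.ofReal (c * (((N : ℝ) + 1) ^ (3 * γ) / Real.sqrt ((N : ℝ) + 1))))
      atTop (𝓝 0) := by
  have h1 : Tendsto (fun N : ℕ => ((N : ℝ) + 1) ^ (3 * γ - 1 / 2)) atTop (𝓝 0) := by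
    have h := (tendsto_rpow_neg_atTop (by linarith : 0 < 1 / 2 - 3 * γ)).comp
      (tendsto_natCast_atTop_atTop.comp (tendsto_add_atTop_nat 1))
    refine h.congr fun N => ?_
    simp only [Function.comp_apply, Nat.cast_add, Nat.cast_one, neg_sub]
  have h2 : ∀ N : ℕ, ((N : ℝ) + 1) ^ (3 * γ) / Real.sqrt ((N : ℝ) + 1) =
      ((N : ℝ) + 1) ^ (3 * γ - 1 / 2) := fun N => by
    rw [Real.sqrt_eq_rpow, ← Real.rpow_sub (by positivity)]
  simp_rw [h2]
  have h3 := ENNReal.tendsto_ofReal (h1.const_mul c)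
  rwa [mul_zero, ENNReal.ofReal_zero] at h3

end BlockStressDominatorConst

open BlockStressDominatorConst in
/-- **Registered stub `stub_blockStressDominatorConst` ([KS-D'], line `hemisphere-affine-slaving`,
crux stmt-AtomisticToContinuum-9518): the two dominators of the block traceless kinetic stress of the
homogeneous hard-sphere gas vanish in mean.** For `0 < σ ≤ 1/2`, `θ > 0`, every flow family `Φ` and
every admissible kernel family `φ` at mesoscale `(N+1)^{-γ}` (`0 < γ ≤ 1/15`),
`E ∫ₓ [Σ_jk ((N+1)⁻¹ Σᵢ φ(xᵢ − x)(v_{ij} v_{ik} − θδ_jk))² + |m̄|² Ē/ρ̄] dx → 0` under the homogeneous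
local Gibbs laws `G_N = localGibbsLaw σ 1 0 θ N (Φ N)`. Second moments after integrating over `x`
first: the centred Gaussian marks are orthogonal across particles (positions ⊗ i.i.d. `N(0, θ id)`
velocities), and `|m̄|² Ē/ρ̄ ≤ (3θ/2)|m̄|² + Ē²/√(N+1) + √(N+1) (Ē − (3θ/2)ρ̄)²` (weighted
Cauchy–Schwarz + Young), whence `E ∫ₓ (A + B) ≤ C K_θ (N+1)^{3γ − 1/2} → 0`
(`lintegral_dominator_le`, `3γ − 1/2 < 0`). [folklore] -/
theorem stub_blockStressDominatorConst : ∀ σ : ℝ, 0 < σ → σ ≤ 1 / 2 → ∀ θ : ℝ, 0 < θ → ∀ (Φ : Flows σ) (γ C : ℝ) (φ : ℕ → T3 → ℝ), 0 < γ → γ ≤ 1 / 15 → AdmissibleKernel γ C φ → Tendsto (fun N : ℕ => ∫⁻ z, (∫⁻ x : T3, ENNReal.ofReal ((∑ j : Fin 3, ∑ k : Fin 3, (((N : ℝ) + 1)⁻¹ * ∑ i : Fin (N + 1), φ N ((z i).1 - x) * ((z i).2 j * (z i).2 k - if j = k then θ else 0)) ^ 2) + ‖mB φ N z x‖ ^ 2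 * (EB φ N z x / rhoB φ N z x))) ∂(Literature.MathematicalPhysics.KineticTheory.localGibbsLaw σ (fun _ => 1) (fun _ => 0) (fun _ => θ) N (Φ N))) atTop (𝓝 0) := by
  intro σ _hσ0 hσ θ hθ Φ γ C φ _hγ hγ hK
  have hφc : ∀ N, Continuous (φ N) := fun N => (hK.1 N).continuous
  have hφM : ∀ (N : ℕ) y, φ N y ≤ C * ((N : ℝ) + 1) ^ (3 * γ) := hK.2.2.2.2.1
  -- the Gaussian constant `K_θ`
  set Kθ : ℝ := (∑ j : Fin 3, ∑ k : Fin 3,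
      ∫ v, (v j * v k - if j = k then θ else 0) ^ 2 ∂(gaussMeasure (0 : V3) θ)) +
    3 / 2 * θ * (∑ l : Fin 3, ∫ v, v l ^ 2 ∂(gaussMeasure (0 : V3) θ)) +
    ∫ v, (‖v‖ ^ 2 / 2) ^ 2 ∂(gaussMeasure (0 : V3) θ) +
    ∫ v, (‖v‖ ^ 2 / 2 - 3 / 2 * θ) ^ 2 ∂(gaussMeasure (0 : V3) θ) with hKθ
  refine tendsto_of_tendsto_of_tendsto_of_le_of_le tendsto_const_nhds
    (tendsto_ofReal_mul_rpow_div_sqrt hγ (C * Kθ)) (fun _ => zero_le) fun N => ?_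
  refine (lintegral_dominator_le hθ hσ Φ N (hφc N) (hK.2.1 N) (hφM N) (hK.2.2.1 N)).trans
    (le_of_eq ?_)
  rw [← hKθ]
  congr 1
  ring

end

end Summit.AtomisticToContinuum.HydrodynamicLimit.Theorems.HemisphereAffineSlaving
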